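import Summits.ABC.ABC.Theorems.TowerFourSubLiouville.Negative.DialCalibration

/-!
# `TowerFourSubLiouville` (stmt-ABC-1649): at `A = 1` even a logarithmic loss `(log c)^A`, `A < 1`, fails

Negative-side calibration lemma of the standing disprover (cycle 2, refuter-cdisprove-stmt-ABC-1649-g2-0):
the quantitative form of `Negative.DialCalibration.not_towerIneq4OneNoEps` (`ε` cannot be dropped at the
conjectural optimum `A = 1` of the level-4 tower dial), tower analogue of
`Literature.Barriers.ABC.EpsilonCannotBeDroppedPolylog`: there is NO constant `C` with
`c ≤ C · Π · (log c)^A` on all positive coprime level-4 tower points, for any fixed real `A < 1`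
(`not_towerIneq4One_logLoss`).  Witness family (Pell `u² − 3v² = 1` with Matiyasevich's `y_N² ∣ y_{N·y_N}`,
`Pell.ysq_dvd_yy`): `w = y_{N+1} ≥ 3^N`, `m = (N+1)·w`, `v = y_m = w²t`, `u = x_m ≤ 4^m`; the point
`x = (1,1,1,1)`, `y = (3,t,1,w)`, `z = (1,u,1,1)` has `c = u²`, `Π = 3tuw ≤ 3c/w` and
`log c ≤ 2 m log 4 ≤ 8(N+1)w ≤ 16 w log w`, so `c/Π ≥ w/3 ≫ log c / log log c`, which beats `(log c)^A`
for every `A < 1` (via `log w ≤ w^δ/δ`, `δ = (1−A)/2`, and `key_growth`).  Whether the loss `log c` itself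
(`A = 1`) can be refuted is left open here: the square part `W² ∣ y_m` of this Lucas sequence is `≲ m`, so
Pell-type families gain at most `≍ log c`.
-/

namespace Summit.ABC.ABC.Theorems.TowerFourSubLiouville.Negative

open scoped BigOperators
open Summit.ABC.ABC.Theses.IneffectiveSubspace

/-- `x_n ≤ 4^n` for the `d = 3` Pell sequence (`x_{n+2} + x_n = 4x_{n+1}`, `Pell.xn_succ_succ`). -/
theorem pell3_x_le_four_pow : ∀ n, Pell.xn one_lt_two' n ≤ 4 ^ n
  | 0 => by simp
  | 1 => by simp
  | n + 2 => by
    have h := Pell.xn_succ_succ one_lt_two' n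
    have ih := pell3_x_le_four_pow (n + 1)
    have h4 : 4 ^ (n + 2) = 4 * 4 ^ (n + 1) := by ring
    omega

/-- `3^n ≤ y_{n+1}` for the `d = 3` Pell sequence (`y_{n+2} = 4y_{n+1} − y_n ≥ 3y_{n+1}`). -/
theorem pell3_three_pow_le_y : ∀ n, 3 ^ n ≤ Pell.yn one_lt_two' (n + 1)
  | 0 => by simp
  | n + 1 => by
    show 3 ^ (n + 1) ≤ Pell.yn one_lt_two' (n + 2)
    have h := Pell.yn_succ_succ one_lt_two' n
    have hmono : Pell.yn one_lt_two' n ≤ Pell.yn one_lt_two' (n + 1) :=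
      (Pell.strictMono_y one_lt_two').monotone (Nat.le_succ n)
    have ih := pell3_three_pow_le_y n
    have h3 : 3 ^ (n + 1) = 3 * 3 ^ n := by ring
    omega

/-- **The Pell–Matiyasevich family.** For every `N` there are `t, w ≥ 1` and `u` with `3^N ≤ w`,
`w²t ≤ u ≤ 4^{(N+1)w}` and `1 + 3(w²t)² = u²` (`w = y_{N+1}`, `u = x_{(N+1)w}`, `w²t = y_{(N+1)w}`). -/
theorem pell_family (N : ℕ) : ∃ t u w : ℕ, 0 < t ∧ 0 < w ∧ 3 ^ N ≤ w ∧ w * w * t ≤ u ∧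
    u ≤ 4 ^ ((N + 1) * w) ∧ 1 + 3 * (w * w * t) ^ 2 = u ^ 2 := by
  obtain ⟨w, hw⟩ : ∃ w, Pell.yn one_lt_two' (N + 1) = w := ⟨_, rfl⟩
  have hw3 : 3 ^ N ≤ w := hw ▸ pell3_three_pow_le_y N
  have hw0 : 0 < w := lt_of_lt_of_le (pow_pos (by norm_num) N) hw3
  obtain ⟨u, hu⟩ : ∃ u, Pell.xn one_lt_two' ((N + 1) * w) = u := ⟨_, rfl⟩
  obtain ⟨v, hv⟩ : ∃ v, Pell.yn one_lt_two' ((N + 1) * w) = v := ⟨_, rfl⟩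
  have hvu : v ≤ u := hu ▸ hv ▸ pell3_y_le_x _
  have heq : 1 + 3 * v ^ 2 = u ^ 2 := by rw [← hu, ← hv, pell3]; ring
  have hdvd : w * w ∣ v := by
    have := Pell.ysq_dvd_yy one_lt_two' (N + 1)
    rwa [hw, hv] at this
  obtain ⟨t, ht⟩ := hdvd
  have hm0 : 0 < (N + 1) * w := Nat.mul_pos (Nat.succ_pos N) hw0
  have hv0 : 0 < v := hv ▸ lt_of_lt_of_le hm0 (Pell.yn_ge_n one_lt_two' _)
  have ht0 : 0 < t := by
    rcases Nat.eq_zero_or_pos t with h0 | h0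
    · rw [h0, mul_zero] at ht; omega
    · exact h0
  have hule : u ≤ 4 ^ ((N + 1) * w) := hu ▸ pell3_x_le_four_pow _
  refine ⟨t, u, w, ht0, hw0, hw3, ht ▸ hvu, hule, ?_⟩
  rw [← ht]; exact heq

/-- The arithmetic extracted from the family: for every `N` there are reals `w ≥ 3^N` and `L ≥ 1`
(`L = log c`) with `w ≤ 3·C·L^A` and `L ≤ 8(N+1)·w`, if `c ≤ C·Π·(log c)^A` holds on all points. -/
theorem logLoss_key {C A : ℝ}
    (h : ∀ x y z : Fin 4 → ℕ, (∀ i, 0 < x i ∧ 0 < y i ∧ 0 < z i) →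
      (∏ i, x i ^ (i.val + 1)) + (∏ i, y i ^ (i.val + 1)) = ∏ i, z i ^ (i.val + 1) →
      Nat.Coprime (∏ i, x i ^ (i.val + 1)) (∏ i, y i ^ (i.val + 1)) →
      ((∏ i, z i ^ (i.val + 1) : ℕ) : ℝ) ≤
        C * ((∏ i, x i * y i * z i : ℕ) : ℝ) * Real.log (((∏ i, z i ^ (i.val + 1) : ℕ) : ℝ)) ^ A)
    (N : ℕ) : ∃ w L : ℝ, (3 : ℝ) ^ N ≤ w ∧ 1 ≤ L ∧ w ≤ 3 * C * L ^ A ∧ L ≤ 8 * ((N : ℝ) + 1) * w := by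
  obtain ⟨t, u, w, ht0, hw0, hw3, hwwt, hule, hfam⟩ := pell_family N
  have hu2 : 2 ≤ u := by nlinarith [hfam, Nat.one_le_iff_ne_zero.mpr (Nat.mul_pos (Nat.mul_pos hw0 hw0) ht0).ne']
  have hu0 : 0 < u := by omega
  have hpt := h ![1, 1, 1, 1] ![3, t, 1, w] ![1, u, 1, 1]
    (by intro i; fin_cases i <;> simp [ht0, hu0, hw0])
    (by simp [Fin.prod_univ_four]; nlinarith [hfam])
    (by simp [Fin.prod_univ_four])
  simp [Fin.prod_univ_four] at hpt
  -- hpt : (u:ℝ)^2 ≤ C * (3 * (t * u) * w) * (2 * Real.log u) ^ A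
  set L : ℝ := 2 * Real.log (u : ℝ) with hLdef
  have huR : (2 : ℝ) ≤ u := by exact_mod_cast hu2
  have hu0R : (0 : ℝ) < u := by linarith
  have hL1 : 1 ≤ L := by
    have h1 : (1 : ℝ) ≤ Real.log ((u : ℝ) ^ 2) := by
      rw [Real.le_log_iff_exp_le (by positivity)]
      have := Real.exp_one_lt_three
      nlinarith
    rw [Real.log_pow] at h1
    rw [hLdef]; exact_mod_cast h1
  have hLA : 0 ≤ L ^ A := Real.rpow_nonneg (by linarith) A
  refine ⟨w, L, by exact_mod_cast hw3, hL1, ?_, ?_⟩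
  · -- from u² ≤ 3C·tuw·L^A and w²t ≤ u:  w ≤ 3 C L^A
    have htR : (0 : ℝ) < t := by exact_mod_cast ht0
    have hwR : (0 : ℝ) < w := by exact_mod_cast hw0
    have hwwt : (w : ℝ) * w * t ≤ u := by exact_mod_cast hwwt
    -- u ≤ 3 C t w L^A
    have h1 : (u : ℝ) ≤ 3 * C * t * w * L ^ A := by
      have e : C * (3 * ((t : ℝ) * u) * w) * L ^ A = (3 * C * t * w * L ^ A) * u := by ring
      have h' : (u : ℝ) * u ≤ (3 * C * t * w * L ^ A) * u := by rw [← e, ← pow_two]; exact hpt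
      exact le_of_mul_le_mul_right h' hu0R
    have h2 : (w : ℝ) * (w * t) ≤ (3 * C * L ^ A) * (w * t) := by
      calc (w : ℝ) * (w * t) = w * w * t := by ring
        _ ≤ u := hwwt
        _ ≤ 3 * C * t * w * L ^ A := h1
        _ = (3 * C * L ^ A) * (w * t) := by ring
    exact le_of_mul_le_mul_right h2 (by positivity)
  · -- L = 2 log u ≤ 2 (N+1) w log 4 ≤ 8 (N+1) w
    have hlog4 : Real.log 4 ≤ 3 := by
      have := Real.log_le_sub_one_of_pos (by norm_num : (0:ℝ) < 4); linarith
    have hule' : (u : ℝ) ≤ (4 : ℝ) ^ ((N + 1) * w) := by exact_mod_cast hule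
    have hlogu : Real.log u ≤ ((N + 1) * w : ℕ) * Real.log 4 := by
      rw [← Real.log_pow]
      exact Real.log_le_log hu0R hule'
    rw [hLdef]
    push_cast at hlogu ⊢
    have hNw : (0 : ℝ) ≤ ((N : ℝ) + 1) * w := by positivity
    nlinarith [hlogu, hlog4, hNw]

/-- **At `A = 1` a loss `(log c)^A` with `A < 1` is still false.** There is no `C` with
`c ≤ C · Π · (log c)^A` for all positive coprime level-4 tower points (`A < 1` real; `log = Real.log`,
`^ = Real.rpow`).  Quantitative form of `not_towerIneq4OneNoEps` (the case `A = 0`). -/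
theorem not_towerIneq4One_logLoss (A : ℝ) (hA : A < 1) :
    ¬ ∃ C : ℝ, ∀ x y z : Fin 4 → ℕ, (∀ i, 0 < x i ∧ 0 < y i ∧ 0 < z i) →
      (∏ i, x i ^ (i.val + 1)) + (∏ i, y i ^ (i.val + 1)) = ∏ i, z i ^ (i.val + 1) →
      Nat.Coprime (∏ i, x i ^ (i.val + 1)) (∏ i, y i ^ (i.val + 1)) →
      ((∏ i, z i ^ (i.val + 1) : ℕ) : ℝ) ≤
        C * ((∏ i, x i * y i * z i : ℕ) : ℝ) * Real.log (((∏ i, z i ^ (i.val + 1) : ℕ) : ℝ)) ^ A := by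
  rintro ⟨C, h⟩
  have key := logLoss_key h
  -- C > 0 (from N = 0)
  have hC : 0 < C := by
    obtain ⟨w, L, hw, hL1, hwC, -⟩ := key 0
    have hLA : 0 < L ^ A := Real.rpow_pos_of_pos (by linarith) A
    by_contra hC0
    have : 3 * C * L ^ A ≤ 0 := by
      have : C * L ^ A ≤ 0 := mul_nonpos_of_nonpos_of_nonneg (not_lt.mp hC0) hLA.le
      linarith
    have h1 : (1 : ℝ) ≤ w := by simpa using hw
    linarith
  have hlog3 : 1 ≤ Real.log 3 := by
    rw [Real.le_log_iff_exp_le (by norm_num)]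
    exact Real.exp_one_lt_three.le
  -- from `3^N ≤ w`: `N ≤ log w`, hence for `N ≥ 1`: `N + 1 ≤ 2 log w`
  have hNlog : ∀ (N : ℕ) (w : ℝ), (3 : ℝ) ^ N ≤ w → (N : ℝ) ≤ Real.log w := by
    intro N w hw
    have h3N : (0 : ℝ) < (3 : ℝ) ^ N := by positivity
    have h1 := Real.log_le_log h3N hw
    rw [Real.log_pow] at h1
    have hN0 : (0 : ℝ) ≤ N := by positivity
    nlinarith
  rcases le_or_gt A 0 with hA0 | hA0
  · -- A ≤ 0: L^A ≤ 1, so w ≤ 3C; take 3^N > 3C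
    obtain ⟨N, hN⟩ := exists_nat_gt (3 * C)
    obtain ⟨w, L, hw, hL1, hwC, -⟩ := key N
    have hLA : L ^ A ≤ 1 := Real.rpow_le_one_of_one_le_of_nonpos hL1 hA0
    have hN3 : (N : ℝ) ≤ (3 : ℝ) ^ N := by exact_mod_cast (Nat.lt_pow_self (by norm_num : 1 < 3)).le
    have : w ≤ 3 * C := by nlinarith [hwC, hLA, hC]
    linarith
  · -- 0 < A < 1
    set δ : ℝ := (1 - A) / 2 with hδ
    have hδ0 : 0 < δ := by rw [hδ]; linarith
    set s : ℝ := (1 + δ) * A with hs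
    have hs1 : s < 1 := by
      rw [hs, hδ]; nlinarith
    set K : ℝ := 2 * (3 * C * ((16 : ℝ) / δ) ^ A) with hK
    have hK0 : 0 ≤ K := by positivity
    obtain ⟨M, hM1, hM⟩ := key_growth hK0 hs1
    obtain ⟨N, hN⟩ := exists_nat_gt (max M 1)
    have hN1 : (1 : ℝ) < N := lt_of_le_of_lt (le_max_right _ _) hN
    have hNM : M < N := lt_of_le_of_lt (le_max_left _ _) hN
    obtain ⟨w, L, hw, hL1, hwC, hLw⟩ := key N
    have hN3 : (N : ℝ) ≤ (3 : ℝ) ^ N := by exact_mod_cast (Nat.lt_pow_self (by norm_num : 1 < 3)).le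
    have hwN : (N : ℝ) ≤ w := le_trans hN3 hw
    have hw1 : (1 : ℝ) < w := lt_of_lt_of_le hN1 hwN
    have hw0 : (0 : ℝ) < w := by linarith
    -- log w ≥ N ≥ 1 and N + 1 ≤ 2 log w
    have hlogw : (N : ℝ) ≤ Real.log w := hNlog N w hw
    have hlogw1 : 1 ≤ Real.log w := le_trans hN1.le hlogw
    have hL16 : L ≤ 16 * w * Real.log w := by
      have : ((N : ℝ) + 1) ≤ 2 * Real.log w := by linarith
      nlinarith [hLw, this, hw0]
    -- log w ≤ w^δ / δ
    have hlogle : Real.log w ≤ w ^ δ / δ := Real.log_le_rpow_div hw0.le hδ0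
    have hLpow : L ≤ (16 / δ) * w ^ (1 + δ) := by
      have h1 : 16 * w * Real.log w ≤ 16 * w * (w ^ δ / δ) :=
        mul_le_mul_of_nonneg_left hlogle (by positivity)
      have h2 : 16 * w * (w ^ δ / δ) = (16 / δ) * w ^ (1 + δ) := by
        rw [Real.rpow_add hw0, Real.rpow_one]; field_simp
      linarith
    -- L^A ≤ (16/δ)^A · w^s
    have hL0 : 0 ≤ L := by linarith
    have hLA : L ^ A ≤ ((16 : ℝ) / δ) ^ A * w ^ s := by
      calc L ^ A ≤ ((16 / δ) * w ^ (1 + δ)) ^ A := Real.rpow_le_rpow hL0 hLpow hA0.le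
        _ = ((16 : ℝ) / δ) ^ A * (w ^ (1 + δ)) ^ A :=
            Real.mul_rpow (by positivity) (Real.rpow_nonneg hw0.le _)
        _ = ((16 : ℝ) / δ) ^ A * w ^ s := by rw [← Real.rpow_mul hw0.le, hs]
    -- combine: w ≤ 3C L^A ≤ (K/2) w^s ≤ w/2
    have hKw := hM w (le_trans hNM.le hwN)
    have h3C : 0 ≤ 3 * C := by linarith
    have : w ≤ 3 * C * (((16 : ℝ) / δ) ^ A * w ^ s) := le_trans hwC (mul_le_mul_of_nonneg_left hLA h3C)
    have hKw' : 3 * C * (((16 : ℝ) / δ) ^ A * w ^ s) = K * w ^ s / 2 := by rw [hK]; ring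
    linarith
end Summit.ABC.ABC.Theorems.TowerFourSubLiouville.Negative
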